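import Summits.ResolutionOfSingularities.ResolutionOfSingularities.Theorems.WeightedInvariantContactCylinderStratumLocalize
import Summits.ResolutionOfSingularities.ResolutionOfSingularities.Theorems.WeightedInvariantContactCylinderGenericSuccessor
import Literature.AlgebraicGeometry.Resolution.AdicCompletionRegular
import Mathlib.RingTheory.Localization.Algebra
import Mathlib.RingTheory.Localization.LocalizationLocalization
import Mathlib.RingTheory.RegularLocalRing.Polynomial
import HarnessLib

/-!
# The top `ι₀`-stratum under the torus factor `S → S[X]_𝔮` — (o44) part (c10-cyl), layer 2: the strata identification at
# `S[X]_𝔮` from POINTWISE letter inequalities (door `HypersurfaceCentreConstruction`, stmt-ResolutionOfSingularities-19897; rung P3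
# `stub_keyRungLE_three`, clause (c10)≤3 for `ι₃ᵗ`; res-type-005, res-L1-w43-plan-1 GO #2 2026-08-27T13:57:22Z, architecture (iii))

Topic: `Summits/ResolutionOfSingularities/ResolutionOfSingularities/Theorems`. Helper for the door item
`HypersurfaceCentreConstruction` (stmt-ResolutionOfSingularities-19897, route `WeightedInvariant`), def-free sequel of
`…ContactCylinderTorusFactor` (layer 1, hypothesis `hE'`).  Registrar's (iii): in the equality case
`ι₀ (S[X]_𝔮) (f) = ι₀ S f`, the top `ι₀`-stratum of `(S[X]_𝔮, f)` is `V(P₀ S[X]_𝔮)`, `P₀` the generic prime of the top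
stratum of `(S, f)`.  This file proves it from POINTWISE inequalities only — no regularity, no ring isomorphisms beyond (c6):
for a prime `𝔮'' ⊂ S[X]_𝔮` with contraction `𝔮' ⊆ 𝔮` in `S[X]` and `𝔭 = 𝔮' ∩ S`,
(⇐) `P₀ S[X] ≤ 𝔮'` ⇒ `ι₀ S f = ι₀ (S_{P₀}) = ι₀ (S[X]_{P₀S[X]}) ≤ ι₀ (S[X]_{𝔮'}) ≤ ι₀ (S[X]_𝔮) = ι₀ S f` (generic-fibre
equality `hgen` + (c7) twice); (⇒) `ι₀ (S[X]_{𝔮'}) = ι₀ S f` with `ι₀ (S[X]_{𝔮'}) ≤ ι₀ (S_𝔭) ≤ ι₀ S f` ((c10) at the position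
`S_𝔭`, `h10'`, + (c7)) forces `𝔭` onto the top stratum `V(P₀)`.  The letter-level inputs are hypotheses (`h7a`, `h7b`, `h7S` =
instances of (c7); `h10'` = (c10) at the generisations `S_𝔭` read in `S[X]`-coordinates; `hgen`); the consumer for
`Iota3.iotaFlatT` (layer 3) discharges them from res-type-013's / res-type-078's clauses.

* `exists_ringEquiv_atPrime_polynomial` — the plumbing `S[X]_{𝔮'} ≅ (S_𝔭[X])_{𝔮₁}` (`𝔭 = 𝔮' ∩ S`, `𝔮₁` over `𝔪_{S_𝔭}`,
  generic point to generic point), with `iota_atPrime_polynomial_le_of_torusFactorMonotone` = (c10) at the generisations in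
  `S[X]`-coordinates and `iota_atPrime_map_C_eq_of_generic` = the generic fibre point in `S[X]`-coordinates;
* **`topStratum_torusFactor_of_eq`** — the identification `hE'` of layer 1 from pointwise inequalities;
* **`topStratum_torusFactor_of_clauses`** — the same from the CLAUSES `IotaGenerizationMonotone ι₀`, `IotaTorusFactorMonotone ι₀`
  and the generic-fibre equality `hgen` (at `T → T[X]_{𝔪_T T[X]}`, `T` regular local), `S` regular local.

[OURS · L1 W4.3 · (o44) (c10-cyl) layer 2]  Replaces the role of NO printed item; NOT a statement of the manuscript
[claim: Hironaka2017, status: under-review]. AI work, weaker than expert review.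

## References

* H. Matsumura, Commutative Ring Theory (1987), Thm. 4.3. [Matsumura1987]
* res-L1-w43-plan-1, GO #2 13:57:22Z architecture (iii) (OURS, AI planning).
-/

noncomputable section

open IsLocalRing Literature.AlgebraicGeometry.Resolution Polynomial
open Summit.ResolutionOfSingularities.ResolutionOfSingularities.Cruxes.HypersurfaceCentreConstruction.LocalEngine

set_option linter.dupNamespace false -- mandated namespace of this single-conjunct summit

namespace Summit.ResolutionOfSingularities.ResolutionOfSingularities.Theorems

namespace ContactCylinder

section Plumbing

/-- **`S[X]_{𝔮'}` is a localisation of `S_𝔭[X]` at a prime over `𝔪_{S_𝔭}`, `𝔭 = 𝔮' ∩ S`** — with the comparison isomorphism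
of local rings carrying `f ∈ S ⊂ S[X]` to `f/1 ∈ S_𝔭 ⊂ S_𝔭[X]`, and the generic fibre point `𝔭S[X]` going to `𝔪_{S_𝔭} S_𝔭[X]`.
[folklore; cite: Matsumura1987, Thm. 4.3] -/
theorem exists_ringEquiv_atPrime_polynomial (S : Type) [CommRing S] (f : S) (𝔮' : Ideal S[X]) [𝔮'.IsPrime]
    (𝔭 : Ideal S) [𝔭.IsPrime] (h𝔭 : 𝔮'.comap (C : S →+* S[X]) = 𝔭) :
    ∃ (𝔮₁ : Ideal (Localization.AtPrime 𝔭)[X]) (_ : 𝔮₁.IsPrime),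
      𝔮₁.comap (C : Localization.AtPrime 𝔭 →+* (Localization.AtPrime 𝔭)[X]) = maximalIdeal (Localization.AtPrime 𝔭) ∧
      (𝔭.map (C : S →+* S[X]) = 𝔮' →
        𝔮₁ = (maximalIdeal (Localization.AtPrime 𝔭)).map (C : Localization.AtPrime 𝔭 →+* (Localization.AtPrime 𝔭)[X])) ∧
      ∃ Φ : Localization.AtPrime 𝔮' ≃+* Localization.AtPrime 𝔮₁,
        Φ (algebraMap S[X] (Localization.AtPrime 𝔮') (C f)) =
          algebraMap (Localization.AtPrime 𝔭)[X] (Localization.AtPrime 𝔮₁)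
            (C (algebraMap S (Localization.AtPrime 𝔭) f)) := by
  letI : Algebra S[X] (Localization.AtPrime 𝔭)[X] := Polynomial.algebra S (Localization.AtPrime 𝔭)
  haveI hloc : IsLocalization (𝔭.primeCompl.map (C : S →+* S[X])) (Localization.AtPrime 𝔭)[X] :=
    Polynomial.isLocalization 𝔭.primeCompl (Localization.AtPrime 𝔭)
  have hdisj : Disjoint ((𝔭.primeCompl.map (C : S →+* S[X]) : Submonoid S[X]) : Set S[X]) (𝔮' : Set S[X]) := by
    rw [Set.disjoint_left]
    rintro _ ⟨s, hs, rfl⟩ hs'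
    exact hs (h𝔭 ▸ (Ideal.mem_comap.mpr hs'))
  haveI h𝔮₁p : (𝔮'.map (algebraMap S[X] (Localization.AtPrime 𝔭)[X])).IsPrime :=
    IsLocalization.isPrime_of_isPrime_disjoint (𝔭.primeCompl.map (C : S →+* S[X])) _ 𝔮' ‹_› hdisj
  have hunder : (𝔮'.map (algebraMap S[X] (Localization.AtPrime 𝔭)[X])).comap
      (algebraMap S[X] (Localization.AtPrime 𝔭)[X]) = 𝔮' :=
    IsLocalization.under_map_of_isPrime_disjoint (𝔭.primeCompl.map (C : S →+* S[X])) _ ‹𝔮'.IsPrime› hdisj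
  haveI : IsLocalization.AtPrime (Localization.AtPrime (𝔮'.map (algebraMap S[X] (Localization.AtPrime 𝔭)[X]))) 𝔮' := by
    have h := IsLocalization.isLocalization_isLocalization_atPrime_isLocalization
      (M := 𝔭.primeCompl.map (C : S →+* S[X])) (S := (Localization.AtPrime 𝔭)[X])
      (T := Localization.AtPrime (𝔮'.map (algebraMap S[X] (Localization.AtPrime 𝔭)[X])))
      (p := 𝔮'.map (algebraMap S[X] (Localization.AtPrime 𝔭)[X]))
    have hM : ((𝔮'.map (algebraMap S[X] (Localization.AtPrime 𝔭)[X])).comap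
        (algebraMap S[X] (Localization.AtPrime 𝔭)[X])).primeCompl = 𝔮'.primeCompl := by
      ext x
      rw [Ideal.mem_primeCompl_iff, Ideal.mem_primeCompl_iff, hunder]
    have h' : IsLocalization ((𝔮'.map (algebraMap S[X] (Localization.AtPrime 𝔭)[X])).comap
        (algebraMap S[X] (Localization.AtPrime 𝔭)[X])).primeCompl
        (Localization.AtPrime (𝔮'.map (algebraMap S[X] (Localization.AtPrime 𝔭)[X]))) := h
    rw [hM] at h'
    exact h'
  refine ⟨𝔮'.map (algebraMap S[X] (Localization.AtPrime 𝔭)[X]), h𝔮₁p, ?_, ?_,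
    (IsLocalization.algEquiv 𝔮'.primeCompl (Localization.AtPrime 𝔮')
      (Localization.AtPrime (𝔮'.map (algebraMap S[X] (Localization.AtPrime 𝔭)[X])))).toRingEquiv, ?_⟩
  · refine le_antisymm (IsLocalRing.le_maximalIdeal (Ideal.IsPrime.ne_top inferInstance)) ?_
    rw [← Localization.AtPrime.map_eq_maximalIdeal, Ideal.map_le_iff_le_comap]
    intro a ha
    rw [Ideal.mem_comap, Ideal.mem_comap, ← Polynomial.map_C (f := algebraMap S (Localization.AtPrime 𝔭))]
    exact Ideal.mem_map_of_mem (algebraMap S[X] (Localization.AtPrime 𝔭)[X])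
      (show C a ∈ 𝔮' from Ideal.mem_comap.mp (h𝔭.symm ▸ ha))
  · intro hgen
    rw [← hgen, Ideal.map_map, ← Localization.AtPrime.map_eq_maximalIdeal, Ideal.map_map]
    congr 1
    exact RingHom.ext fun a => by simp [Polynomial.map_C]
  · change (IsLocalization.algEquiv 𝔮'.primeCompl (Localization.AtPrime 𝔮') _) (algebraMap S[X] _ (C f)) = _
    rw [AlgEquiv.commutes, IsScalarTower.algebraMap_apply S[X] (Localization.AtPrime 𝔭)[X]
      (Localization.AtPrime (𝔮'.map (algebraMap S[X] (Localization.AtPrime 𝔭)[X])))]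
    congr 1
    rw [Polynomial.algebraMap_def, Polynomial.coe_mapRingHom, Polynomial.map_C]

/-- **(c10) AT THE GENERISATIONS, IN `S[X]`-COORDINATES**: from the torus-factor clause for `ι₀` at the positions `S_𝔭`:
`ι₀ (S[X]_{𝔮'}) (f) ≤ ι₀ (S_{𝔮' ∩ S}) (f)` for every prime `𝔮' ⊂ S[X]` (`S` regular local). [OURS · L1 W4.3 · (o44) (c10-cyl)] -/
theorem iota_atPrime_polynomial_le_of_torusFactorMonotone {ι₀ : (R : Type) → [CommRing R] → R → Ordinal.{0}}
    (hι₀ : IotaIsoInvariant ι₀) (h10 : IotaTorusFactorMonotone ι₀) (S : Type) [CommRing S] [IsRegularLocalRing S] (f : S)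
    (𝔮' : Ideal S[X]) [𝔮'.IsPrime] :
    ι₀ (Localization.AtPrime 𝔮') (algebraMap S[X] (Localization.AtPrime 𝔮') (C f)) ≤
      ι₀ (Localization.AtPrime (𝔮'.comap (C : S →+* S[X])))
        (algebraMap S (Localization.AtPrime (𝔮'.comap (C : S →+* S[X]))) f) := by
  haveI : IsRegularRing S := isRegularRing_of_isRegularLocalRing S
  obtain ⟨𝔮₁, h𝔮₁, hmax, -, Φ, hΦ⟩ := exists_ringEquiv_atPrime_polynomial S f 𝔮' (𝔮'.comap (C : S →+* S[X])) rfl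
  rw [← iota_ringEquiv_atPrime (𝔫 := 𝔮') (𝔫' := 𝔮₁) hι₀ Φ, hΦ]
  exact h10 (Localization.AtPrime (𝔮'.comap (C : S →+* S[X]))) _ 𝔮₁ hmax

/-- **THE GENERIC FIBRE POINT, IN `S[X]`-COORDINATES**: a clause stated at `T[X]_{𝔪_T T[X]}` (`T` regular local) transported to
`S[X]_{𝔭S[X]}` with `T = S_𝔭`. [OURS · L1 W4.3 · (o44) (c10-cyl)] -/
theorem iota_atPrime_map_C_eq_of_generic {ι₀ : (R : Type) → [CommRing R] → R → Ordinal.{0}} (hι₀ : IotaIsoInvariant ι₀)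
    (S : Type) [CommRing S] (f : S) (𝔭 : Ideal S) [𝔭.IsPrime] [(𝔭.map (C : S →+* S[X])).IsPrime] :
    ∃ _ : ((maximalIdeal (Localization.AtPrime 𝔭)).map
        (C : Localization.AtPrime 𝔭 →+* (Localization.AtPrime 𝔭)[X])).IsPrime,
      ι₀ (Localization.AtPrime (𝔭.map (C : S →+* S[X]))) (algebraMap S[X] _ (C f)) =
        ι₀ (Localization.AtPrime ((maximalIdeal (Localization.AtPrime 𝔭)).map
          (C : Localization.AtPrime 𝔭 →+* (Localization.AtPrime 𝔭)[X])))
          (algebraMap (Localization.AtPrime 𝔭)[X] _ (C (algebraMap S (Localization.AtPrime 𝔭) f))) := by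
  have hcomap : (𝔭.map (C : S →+* S[X])).comap (C : S →+* S[X]) = 𝔭 := by
    ext a
    rw [Ideal.mem_comap, Ideal.mem_map_C_iff]
    constructor
    · intro h; simpa using h 0
    · intro h n; rw [coeff_C]; split_ifs <;> simp [h]
  obtain ⟨𝔮₁, h𝔮₁, -, hgen, Φ, hΦ⟩ := exists_ringEquiv_atPrime_polynomial S f (𝔭.map (C : S →+* S[X])) 𝔭 hcomap
  obtain rfl := hgen rfl
  exact ⟨h𝔮₁, by rw [← iota_ringEquiv_atPrime (𝔫 := 𝔭.map (C : S →+* S[X])) (𝔫' := _) hι₀ Φ, hΦ]⟩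

end Plumbing

section TorusStrata

variable {ι₀ ι₁ : (R : Type) → [CommRing R] → R → Ordinal.{0}}

/-- A prime of `A_𝔮` contracts into `𝔮`. [folklore] -/
theorem comap_le_of_prime_atPrime {A : Type} [CommRing A] (𝔮 : Ideal A) [𝔮.IsPrime]
    (𝔮'' : PrimeSpectrum (Localization.AtPrime 𝔮)) : 𝔮''.asIdeal.comap (algebraMap A (Localization.AtPrime 𝔮)) ≤ 𝔮 := by
  intro a ha
  rw [Ideal.mem_comap] at ha
  have hle : 𝔮''.asIdeal ≤ maximalIdeal (Localization.AtPrime 𝔮) := IsLocalRing.le_maximalIdeal 𝔮''.isPrime.ne_top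
  have h := hle ha
  rw [← Localization.AtPrime.under_maximalIdeal (I := 𝔮), Ideal.under_def, Ideal.mem_comap]
  exact h

/-- **(c10-cyl), layer 2: THE TOP `ι₀`-STRATUM OF `(S[X]_𝔮, f)` IS `V(P₀ S[X]_𝔮)` in the equality case**, from pointwise letter
inequalities (see the module docstring for the two sandwiches). [OURS · L1 W4.3 · (o44) (c10-cyl)] -/
theorem topStratum_torusFactor_of_eq (hι₀ : IotaIsoInvariant ι₀) (S : Type) [CommRing S] (f : S) (P₀ : Ideal S)
    [P₀.IsPrime] (hE : topStratum ι₀ S f = {𝔭 | P₀ ≤ 𝔭.asIdeal}) (𝔮 : Ideal S[X]) [𝔮.IsPrime]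
    (heq : ι₀ (Localization.AtPrime 𝔮) (algebraMap S[X] (Localization.AtPrime 𝔮) (C f)) = ι₀ S f)
    (hgen : ∀ [(P₀.map (C : S →+* S[X])).IsPrime],
      ι₀ (Localization.AtPrime (P₀.map (C : S →+* S[X]))) (algebraMap S[X] _ (C f)) =
        ι₀ (Localization.AtPrime P₀) (algebraMap S (Localization.AtPrime P₀) f))
    (h7a : ∀ (𝔮' : Ideal S[X]) [𝔮'.IsPrime], 𝔮' ≤ 𝔮 →
      ι₀ (Localization.AtPrime 𝔮') (algebraMap S[X] (Localization.AtPrime 𝔮') (C f)) ≤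
        ι₀ (Localization.AtPrime 𝔮) (algebraMap S[X] (Localization.AtPrime 𝔮) (C f)))
    (h7b : ∀ (𝔮' : Ideal S[X]) [𝔮'.IsPrime] [(P₀.map (C : S →+* S[X])).IsPrime], P₀.map (C : S →+* S[X]) ≤ 𝔮' →
      ι₀ (Localization.AtPrime (P₀.map (C : S →+* S[X]))) (algebraMap S[X] _ (C f)) ≤
        ι₀ (Localization.AtPrime 𝔮') (algebraMap S[X] (Localization.AtPrime 𝔮') (C f)))
    (h10' : ∀ (𝔮' : Ideal S[X]) [𝔮'.IsPrime], 𝔮' ≤ 𝔮 →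
      ι₀ (Localization.AtPrime 𝔮') (algebraMap S[X] (Localization.AtPrime 𝔮') (C f)) ≤
        ι₀ (Localization.AtPrime (𝔮'.comap (C : S →+* S[X])))
          (algebraMap S (Localization.AtPrime (𝔮'.comap (C : S →+* S[X]))) f))
    (h7S : ∀ (𝔭 : Ideal S) [𝔭.IsPrime], ι₀ (Localization.AtPrime 𝔭) (algebraMap S (Localization.AtPrime 𝔭) f) ≤ ι₀ S f) :
    topStratum ι₀ (Localization.AtPrime 𝔮) (algebraMap S[X] (Localization.AtPrime 𝔮) (C f)) =
      {𝔮'' | (P₀.map (C : S →+* S[X])).map (algebraMap S[X] (Localization.AtPrime 𝔮)) ≤ 𝔮''.asIdeal} := by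
  haveI hP₀C : (P₀.map (C : S →+* S[X])).IsPrime := Ideal.isPrime_map_C_of_isPrime
  -- `ι₀` at `S_{P₀}` is the value at `S`
  have hP₀val : ι₀ (Localization.AtPrime P₀) (algebraMap S (Localization.AtPrime P₀) f) = ι₀ S f :=
    iota_localization_eq_of_topStratum_eq S P₀ P₀ le_rfl f hE
  ext 𝔮''
  have hq'le : 𝔮''.asIdeal.comap (algebraMap S[X] (Localization.AtPrime 𝔮)) ≤ 𝔮 := comap_le_of_prime_atPrime 𝔮 𝔮''
  rw [mem_topStratum_iff, iota_atPrime_atPrime_eq hι₀ S[X] 𝔮 (C f) 𝔮'', heq, Set.mem_setOf_eq, Ideal.map_le_iff_le_comap]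
  constructor
  · -- (⇒): equality forces `𝔭 = 𝔮' ∩ S` onto the top stratum of `(S, f)`
    intro hval
    have h1 := h10' (𝔮''.asIdeal.comap (algebraMap S[X] (Localization.AtPrime 𝔮))) hq'le
    rw [hval] at h1
    have h2 := h7S ((𝔮''.asIdeal.comap (algebraMap S[X] (Localization.AtPrime 𝔮))).comap (C : S →+* S[X]))
    have h𝔭 : (⟨(𝔮''.asIdeal.comap (algebraMap S[X] (Localization.AtPrime 𝔮))).comap (C : S →+* S[X]), inferInstance⟩ :
        PrimeSpectrum S) ∈ topStratum ι₀ S f := le_antisymm h2 h1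
    rw [hE] at h𝔭
    exact Ideal.map_le_iff_le_comap.mpr h𝔭
  · -- (⇐): the sandwich `ι₀ S f = ι₀ (S[X]_{P₀S[X]}) ≤ ι₀ (S[X]_{𝔮'}) ≤ ι₀ (S[X]_𝔮) = ι₀ S f`
    intro hle
    refine le_antisymm (le_of_le_of_eq (h7a _ hq'le) heq) ?_
    calc ι₀ S f = ι₀ (Localization.AtPrime P₀) (algebraMap S (Localization.AtPrime P₀) f) := hP₀val.symm
      _ = ι₀ (Localization.AtPrime (P₀.map (C : S →+* S[X]))) (algebraMap S[X] _ (C f)) := hgen.symm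
      _ ≤ _ := h7b _ hle


/-- `ι` at `A_I` only depends on the ideal `I` (not on the primality witness). [folklore] -/
theorem iota_atPrime_congr_ideal (A : Type) [CommRing A] {I J : Ideal A} [I.IsPrime] [J.IsPrime] (h : I = J) (x : A) :
    ι₀ (Localization.AtPrime I) (algebraMap A (Localization.AtPrime I) x) =
      ι₀ (Localization.AtPrime J) (algebraMap A (Localization.AtPrime J) x) := by
  subst h
  rfl

/-- **(c7) BETWEEN TWO PRIMES `I ≤ J` OF ANY RING, IN `A`-COORDINATES**: `ι₀ (A_I) (x) ≤ ι₀ (A_J) (x)` when `A_J` is a regular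
local ring (generisation monotonicity at the position `A_J`, read back in `A` by (c6)). [OURS · L1 W4.3 · (o44)] -/
theorem iota_atPrime_le_of_le (hι₀ : IotaIsoInvariant ι₀) (h7 : IotaGenerizationMonotone ι₀) (A : Type) [CommRing A]
    (I J : Ideal A) [I.IsPrime] [J.IsPrime] (hIJ : I ≤ J) [IsRegularLocalRing (Localization.AtPrime J)] (x : A) :
    ι₀ (Localization.AtPrime I) (algebraMap A (Localization.AtPrime I) x) ≤
      ι₀ (Localization.AtPrime J) (algebraMap A (Localization.AtPrime J) x) := by
  have hdisj : Disjoint (J.primeCompl : Set A) (I : Set A) := by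
    rw [Set.disjoint_left]
    intro a ha hI
    exact ha (hIJ hI)
  haveI hp : (I.map (algebraMap A (Localization.AtPrime J))).IsPrime :=
    IsLocalization.isPrime_of_isPrime_disjoint J.primeCompl _ I ‹_› hdisj
  have hunder : (I.map (algebraMap A (Localization.AtPrime J))).comap (algebraMap A (Localization.AtPrime J)) = I :=
    IsLocalization.under_map_of_isPrime_disjoint J.primeCompl _ ‹I.IsPrime› hdisj
  have h := h7 (Localization.AtPrime J) (I.map (algebraMap A (Localization.AtPrime J)))
    (algebraMap A (Localization.AtPrime J) x)
  rw [iota_atPrime_atPrime_eq hι₀ A J x ⟨I.map (algebraMap A (Localization.AtPrime J)), hp⟩,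
    iota_atPrime_congr_ideal (ι₀ := ι₀) A hunder x] at h
  exact h

/-- **(c10-cyl), layer 2 FROM THE CLAUSES**: for `S` regular local, `ι₀` iso-invariant (c6), generisation-monotone (c7) and
torus-factor-monotone (c10), and with the generic-fibre equality `hgen : ι₀ (T[X]_{𝔪_T T[X]}) (g) = ι₀ T g` at regular local `T`,
the top `ι₀`-stratum of `(S[X]_𝔮, f)` in the equality case is `V(P₀ S[X]_𝔮)`. [OURS · L1 W4.3 · (o44) (c10-cyl)] -/
theorem topStratum_torusFactor_of_clauses (hι₀ : IotaIsoInvariant ι₀) (h7 : IotaGenerizationMonotone ι₀)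
    (h10 : IotaTorusFactorMonotone ι₀)
    (hgen : ∀ (T : Type) [CommRing T] [IsRegularLocalRing T] (g : T)
      [((maximalIdeal T).map (C : T →+* T[X])).IsPrime],
      ι₀ (Localization.AtPrime ((maximalIdeal T).map (C : T →+* T[X]))) (algebraMap T[X] _ (C g)) = ι₀ T g)
    (S : Type) [CommRing S] [IsRegularLocalRing S] (f : S) (P₀ : Ideal S) [P₀.IsPrime]
    (hE : topStratum ι₀ S f = {𝔭 | P₀ ≤ 𝔭.asIdeal}) (𝔮 : Ideal S[X]) [𝔮.IsPrime]
    (heq : ι₀ (Localization.AtPrime 𝔮) (algebraMap S[X] (Localization.AtPrime 𝔮) (C f)) = ι₀ S f) :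
    topStratum ι₀ (Localization.AtPrime 𝔮) (algebraMap S[X] (Localization.AtPrime 𝔮) (C f)) =
      {𝔮'' | (P₀.map (C : S →+* S[X])).map (algebraMap S[X] (Localization.AtPrime 𝔮)) ≤ 𝔮''.asIdeal} := by
  haveI : IsRegularRing S := isRegularRing_of_isRegularLocalRing S
  haveI hP₀C : (P₀.map (C : S →+* S[X])).IsPrime := Ideal.isPrime_map_C_of_isPrime
  refine topStratum_torusFactor_of_eq hι₀ S f P₀ hE 𝔮 heq ?_ ?_ ?_ ?_ ?_
  · intro _
    obtain ⟨h𝔮₁, h1⟩ := iota_atPrime_map_C_eq_of_generic hι₀ S f P₀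
    rw [h1]
    exact hgen (Localization.AtPrime P₀) (algebraMap S (Localization.AtPrime P₀) f)
  · intro 𝔮' _ h𝔮'
    exact iota_atPrime_le_of_le hι₀ h7 S[X] 𝔮' 𝔮 h𝔮' (C f)
  · intro 𝔮' _ _ hle
    exact iota_atPrime_le_of_le hι₀ h7 S[X] _ 𝔮' hle (C f)
  · intro 𝔮' _ _
    exact iota_atPrime_polynomial_le_of_torusFactorMonotone hι₀ h10 S f 𝔮'
  · intro 𝔭 _
    exact h7 S 𝔭 f

end TorusStrata

end ContactCylinder

end Summit.ResolutionOfSingularities.ResolutionOfSingularities.Theorems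

end
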